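import Summits.CriticalPhenomena.PercolationContinuityZ3.Theorems.PercAnnulusCrossingIICUniquenessJunk
import HarnessLib

/-!
# Kesten–Basu–Sapozhnikov IIC scheme in boxes, XVIII: choice of scales with small junk (lane RSW3, p1 gen 3)

builds on p205010 (kernel theorem, internal audit signed; external expert review pending)

Seat `prim-rsw3-p1` (gen 3); LANE-4 blueprint, memo `run/shared/lean/prim/rsw3/P1-QM.md` §13.4 step (4).  Helper file; no definitions, no
sorries.  When `θ(p) = 0` the annulus-crossing probability `α(a,b) = P(Λ(a) ↔ ∂ⁱⁿΛ(b))` tends to `0` as `b → ∞`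
(`tendsto_real_boxCrossing_of_theta_eq_zero`), so the scales of Kesten's scheme (part XVII) can be chosen inside-out with every junk
term `≤ δ`.
* `exists_box_sym2_superset` — a finite set of pairs lies in `Λ(a₀).sym2` for some `a₀`;
* **`exists_scheme_scales`** — for `θ(p) = 0`, `δ > 0`, `a₀, L`: scale functions `M1 M2 μ1 μ2` (scheme-level indexed, `0` outermost) with
  `1 ≤ M1 l`, `4 M1 l < 2 M2 l`, `α(2M1 l, 2M2 l) ≤ δ` (`l ≤ L`), `2(2M2(l+1)+1)+1 ≤ μ1 l`, `4μ1 l < 2μ2 l ≤ 2 M1 l`,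
  `α(2μ1 l, 2μ2 l) ≤ δ` (`l < L`), and `a₀ ≤ 2 M1 L`.
References: H. Kesten, PTRF 73 (1986) §2; D. Basu, A. Sapozhnikov, ECP 22 (2017) no. 26, §2.
-/

noncomputable section

namespace Summit.CriticalPhenomena.PercolationContinuityZ3.Theorems.Crossing

open MeasureTheory Filter Topology Literature.Probability.Percolation Literature.Probability.LatticeModels
open Literature.Probability.Percolation.DCT16
open Summit.CriticalPhenomena.PercolationContinuityZ3.Theorems.SurfaceTension
open scoped Literature.Probability.Percolation

variable {d : ℕ}

/-- A finite set of pairs of sites lies in `Λ(a₀).sym2` for some `a₀`. [folklore] -/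
theorem exists_box_sym2_superset (F : Finset (Sym2 (Site d))) : ∃ a₀ : ℕ, F ⊆ (box d a₀).sym2 := by
  classical
  have hsite : ∀ x : Site d, ∃ a : ℕ, x ∈ box d a := by
    intro x
    refine ⟨Finset.univ.sup fun i => (x i).natAbs, ?_⟩
    rw [mem_box]
    intro i
    have h : (x i).natAbs ≤ Finset.univ.sup fun i => (x i).natAbs := Finset.le_sup (f := fun i => (x i).natAbs) (Finset.mem_univ i)
    constructor <;> omega
  induction F using Finset.induction_on with
  | empty => exact ⟨0, Finset.empty_subset _⟩
  | insert e s hes ih =>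
    obtain ⟨a₁, ha₁⟩ := ih
    induction e using Sym2.ind with
    | h x y =>
      obtain ⟨ax, hax⟩ := hsite x
      obtain ⟨ay, hay⟩ := hsite y
      refine ⟨max a₁ (max ax ay), Finset.insert_subset ?_ (ha₁.trans (Finset.sym2_mono (box_mono d (le_max_left _ _))))⟩
      rw [Finset.mk_mem_sym2_iff]
      exact ⟨box_mono d ((le_max_left _ _).trans (le_max_right _ _)) hax,
        box_mono d ((le_max_right _ _).trans (le_max_right _ _)) hay⟩

/-- **Scales for Kesten's scheme with junk `≤ δ`** (`θ(p) = 0`): see the module docstring. [cite: Kesten1986, §2] -/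
theorem exists_scheme_scales (p : unitInterval) (hθ : theta (zdGraph d) 0 p = 0) {δ : ℝ} (hδ : 0 < δ) (a₀ L : ℕ) :
    ∃ M1 M2 μ1 μ2 : ℕ → ℕ,
      (∀ l ≤ L, 1 ≤ M1 l ∧ 4 * M1 l < 2 * M2 l ∧ (bondPercolation (zdGraph d) p).real (boxCrossing d (2 * M1 l) (2 * M2 l)) ≤ δ) ∧
      (∀ l < L, 2 * (2 * M2 (l + 1) + 1) + 1 ≤ μ1 l ∧ 4 * μ1 l < 2 * μ2 l ∧ μ2 l ≤ M1 l ∧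
        (bondPercolation (zdGraph d) p).real (boxCrossing d (2 * μ1 l) (2 * μ2 l)) ≤ δ) ∧
      a₀ ≤ 2 * M1 L := by
  set μ := bondPercolation (zdGraph d) p with hμ
  -- junk choice: for every `a` and lower bound `B` an outer radius `b ≥ B` with `α(a, 2b) ≤ δ`
  have hjunk : ∀ a B : ℕ, ∃ b : ℕ, B ≤ b ∧ μ.real (boxCrossing d a (2 * b)) ≤ δ := by
    intro a B
    have ht := tendsto_real_boxCrossing_of_theta_eq_zero (d := d) p hθ a
    obtain ⟨K, hK⟩ := eventually_atTop.1 ((tendsto_order.1 ht).2 δ hδ)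
    exact ⟨max B K, le_max_left _ _, (hK _ ((le_max_right _ _).trans (Nat.le_mul_of_pos_left _ (by norm_num)))).le⟩
  -- construction-indexed scales (`j = 0` innermost)
  have build : ∀ J : ℕ, ∃ A1 A2 ν1 ν2 : ℕ → ℕ,
      (∀ j ≤ J, 1 ≤ A1 j ∧ 4 * A1 j < 2 * A2 j ∧ μ.real (boxCrossing d (2 * A1 j) (2 * A2 j)) ≤ δ) ∧
      (∀ j < J, 2 * (2 * A2 j + 1) + 1 ≤ ν1 j ∧ 4 * ν1 j < 2 * ν2 j ∧ ν2 j ≤ A1 (j + 1) ∧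
        μ.real (boxCrossing d (2 * ν1 j) (2 * ν2 j)) ≤ δ) ∧
      a₀ ≤ 2 * A1 0 := by
    intro J
    induction J with
    | zero =>
      obtain ⟨b, hb, hαb⟩ := hjunk (2 * (a₀ + 1)) (2 * (a₀ + 1) + 1)
      refine ⟨fun _ => a₀ + 1, fun _ => b, fun _ => 0, fun _ => 0, fun j hj => ?_,
        fun j hj => absurd hj (Nat.not_lt_zero _), ?_⟩
      · beta_reduce; exact ⟨by omega, by omega, hαb⟩
      · beta_reduce; omega
    | succ J ih =>
      obtain ⟨A1, A2, ν1, ν2, hA, hν, h0⟩ := ih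
      obtain ⟨b1, hb1, hαb1⟩ := hjunk (2 * (2 * (2 * A2 J + 1) + 1)) (2 * (2 * (2 * A2 J + 1) + 1) + 1)
      obtain ⟨b2, hb2, hαb2⟩ := hjunk (2 * b1) (2 * b1 + 1)
      refine ⟨fun j => if j ≤ J then A1 j else b1, fun j => if j ≤ J then A2 j else b2,
        fun j => if j < J then ν1 j else 2 * (2 * A2 J + 1) + 1, fun j => if j < J then ν2 j else b1,
        fun j hj => ?_, fun j hj => ?_, by beta_reduce; rw [if_pos (Nat.zero_le J)]; exact h0⟩
      · by_cases hjJ : j ≤ J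
        · beta_reduce; rw [if_pos hjJ, if_pos hjJ]; exact hA j hjJ
        · beta_reduce; rw [if_neg hjJ, if_neg hjJ]
          exact ⟨by omega, by omega, hαb2⟩
      · by_cases hjJ : j < J
        · have h1 : j ≤ J := hjJ.le
          have h2 : j + 1 ≤ J := hjJ
          beta_reduce; rw [if_pos hjJ, if_pos hjJ, if_pos h1, if_pos h2]
          exact hν j hjJ
        · have hj' : j = J := by omega
          subst hj'
          beta_reduce
          rw [if_neg (lt_irrefl j), if_neg (lt_irrefl j), if_pos (le_refl j), if_neg (show ¬ (j + 1 ≤ j) from by omega)]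
          exact ⟨le_rfl, by omega, le_rfl, hαb1⟩
  obtain ⟨A1, A2, ν1, ν2, hA, hν, h0⟩ := build L
  refine ⟨fun l => A1 (L - l), fun l => A2 (L - l), fun l => ν1 (L - l - 1), fun l => ν2 (L - l - 1),
    fun l hl => hA (L - l) (by omega), fun l hl => ?_, by beta_reduce; rw [Nat.sub_self]; exact h0⟩
  have e1 : L - (l + 1) = L - l - 1 := by omega
  have e2 : L - l - 1 + 1 = L - l := by omega
  obtain ⟨h1, h2, h3, h4⟩ := hν (L - l - 1) (by omega)
  beta_reduce
  rw [e1]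
  rw [e2] at h3
  exact ⟨h1, h2, h3, h4⟩

end Summit.CriticalPhenomena.PercolationContinuityZ3.Theorems.Crossing

end
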